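import Literature.Probability.LatticeModels.IsingLaceThrough
import HarnessLib

/-!
# The calculus of Sakai's operation `Θ_{v,x;𝒜}[X]` and a priori bounds on the nested kernels

Topic `Probability/LatticeModels`, grouping namespace `IsingLace` (continuation of
`IsingLaceCoefficients.lean` and `IsingLaceThrough.lean`; same setting: Ising model with uniform
coupling `β` on a finite simple graph `G`, Sakai's `Λ` with `𝔹_Λ = E(G)`, removed set `𝒜`).

Sakai 2007, §2.2.3 completes the lace expansion by substituting the second-expansion identity
(2.35) into the innermost level of the remainder `R^{(j)}_Λ` ((2.40)) and *expanding the
operation `Θ` linearly* ("we can rewrite (2.41) as (2.42)"). This file supplies the elementary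
analysis that this step uses silently, for the tree's `IsingLace.theta` ((2.30), an absolutely
convergent series over pairs of currents):

* absolute convergence for bounded `X` (`summable_thetaSummand`); the total mass
  `Σ (w_{𝒜ᶜ}(m)/Z_{𝒜ᶜ})(w_Λ(n)/Z_Λ) 1{∂m = ∅}1{∂n = v△x} = ⟨φ_vφ_x⟩_Λ` (`tsum_thetaWeight_eq`);
* linearity in `X`: `theta_add`, `theta_sub`, `theta_const_mul`, `theta_mul_const`,
  `theta_finset_sum`, `theta_sum_mul` (bounded arguments);
* for `β ≥ 0` (ferromagnetic case, all weights nonnegative, §2.2.3 last paragraph): monotonicity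
  `theta_mono`, the bound `|Θ_{v,x;𝒜}[X]| ≤ (sup |X|) ⟨φ_vφ_x⟩_Λ ≤ sup |X|` (`abs_theta_le`,
  `abs_theta_le'`), `0 ≤ ⟨φ_xφ_y⟩_{𝒜ᶜ}` (`twoPointOff_nonneg`), and a priori bounds on the nested
  kernels (2.39)–(2.40): `0 ≤ piKernel k ≤ |𝔻|^k`, `|rKernel k| ≤ |𝔻|^{k+1}` (`piKernel_le_pow`,
  `abs_rKernel_le_pow`, `𝔻` = directed bonds), `0 ≤ rKernel k` (`rKernel_nonneg`, from
  Proposition 2.2's corollary `⟨φφ⟩_{𝒞ᶜ} ≤ ⟨φφ⟩_Λ`).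

Everything here is proved; no named facts.

## References

* A. Sakai, *Lace expansion for the Ising model*, Comm. Math. Phys. 272 (2007) 283–344,
  arXiv:math-ph/0510093: §2.2.2 ((2.30)), §2.2.3 ((2.36)–(2.42) and the last paragraph)
  [Sakai2007].
-/

noncomputable section

open Finset
open scoped symmDiff BigOperators

namespace Literature.Probability.LatticeModels

variable {V : Type*} [Fintype V] [DecidableEq V] {G : SimpleGraph V} [DecidableRel G.Adj]

namespace IsingLace

/-- `0 ≤ tanh β` for `β ≥ 0`. [folklore] -/
theorem tanh_nonneg_of_nonneg {β : ℝ} (hβ : 0 ≤ β) : 0 ≤ Real.tanh β := by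
  rw [Real.tanh_eq_sinh_div_cosh]
  exact div_nonneg (Real.sinh_nonneg_iff.2 hβ) (Real.cosh_pos _).le

/-- `|tanh β| ≤ 1`. [folklore] -/
theorem abs_tanh_le_one (β : ℝ) : |Real.tanh β| ≤ 1 := by
  rw [abs_le]
  exact ⟨(Real.neg_one_lt_tanh β).le, (Real.tanh_lt_one β).le⟩

/-! ## The weights of `Θ` -/

section Weights

variable (β : ℝ) (A : Finset V) (v x : V)

/-- The normalised pair weight of `Θ_{v,x;𝒜}`:
`(w_{𝒜ᶜ}(m)/Z_{𝒜ᶜ}) 1{∂m = ∅, m ⊆ 𝔹_{𝒜ᶜ}} · (w_Λ(n)/Z_Λ) 1{∂n = v△x}`. [cite: Sakai2007, (2.30)] -/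
def thetaWeight (p : Current G × Current G) : ℝ :=
  (if Current.IsSupp (offGraph G A) p.1 ∧ p.1.sources = ∅ then p.1.weight β / zOff G β A else 0) *
    (if p.2.sources = {v} ∆ {x} then p.2.weight β / zOff G β ∅ else 0)

/-- The normalised pair weight as `(Z_{𝒜ᶜ} Z_Λ)⁻¹` times the unnormalised one. [folklore] -/
theorem thetaWeight_eq (p : Current G × Current G) :
    thetaWeight (G := G) β A v x p = (zOff G β A * zOff G β ∅)⁻¹ *
      ((if Current.IsSupp (offGraph G A) p.1 ∧ p.1.sources = ∅ then p.1.weight β else 0) *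
        (if p.2.sources = {v} ∆ {x} then p.2.weight β else 0)) := by
  unfold thetaWeight
  split_ifs <;> ring

open Classical in
/-- `Θ_{v,x;𝒜}[X]` is the series `Σ_p thetaWeight(p) 1{E_{m+n}(v,x;𝒜)} X(m+n)`. [cite: Sakai2007, (2.30)] -/
theorem theta_eq_tsum (X : Current G → ℝ) :
    theta G β A v x X = ∑' p : Current G × Current G,
      thetaWeight (G := G) β A v x p * (if laceEvent G (p.1 + p.2) A v x then X (p.1 + p.2) else 0) :=
  rfl

variable {β A v x}

/-- `thetaWeight · Φ` is absolutely summable for bounded `Φ`. [folklore] -/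
theorem summable_thetaWeight_mul {Φ : Current G × Current G → ℝ} {C : ℝ} (hΦ : ∀ p, |Φ p| ≤ C) :
    Summable fun p : Current G × Current G => thetaWeight (G := G) β A v x p * Φ p := by
  have h := summable_offPair_mul (G := G) β A ({v} ∆ {x}) hΦ
  refine (h.mul_left ((zOff G β A * zOff G β ∅)⁻¹)).congr fun p => ?_
  rw [thetaWeight_eq]
  ring

open Classical in
/-- The summands of `Θ_{v,x;𝒜}[X]` are absolutely summable for bounded `X`. [cite: Sakai2007, (2.30)] -/
theorem summable_thetaSummand {X : Current G → ℝ} {C : ℝ} (hX : ∀ N, |X N| ≤ C) :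
    Summable fun p : Current G × Current G =>
      thetaWeight (G := G) β A v x p * (if laceEvent G (p.1 + p.2) A v x then X (p.1 + p.2) else 0) := by
  have hC : 0 ≤ C := (abs_nonneg _).trans (hX 0)
  exact summable_thetaWeight_mul (C := C) fun p => by
    split_ifs
    · exact hX _
    · rw [abs_zero]; exact hC

/-- The weights are nonnegative for `β ≥ 0`. [cite: Sakai2007, §2.2.3 ("τ_b and w_𝒜(n) … are nonnegative")] -/
theorem thetaWeight_nonneg (hβ : 0 ≤ β) (p : Current G × Current G) :
    0 ≤ thetaWeight (G := G) β A v x p := by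
  unfold thetaWeight
  refine mul_nonneg ?_ ?_
  · split_ifs
    · exact div_nonneg (Current.weight_nonneg hβ _) (zOff_pos β A).le
    · exact le_rfl
  · split_ifs
    · exact div_nonneg (Current.weight_nonneg hβ _) (zOff_pos β ∅).le
    · exact le_rfl

variable (β A v x) in
/-- **The total mass of the weights of `Θ_{v,x;𝒜}` is `⟨φ_vφ_x⟩_Λ`**:
`Σ_{∂m=∅, ∂n=v△x} (w_{𝒜ᶜ}(m)/Z_{𝒜ᶜ})(w_Λ(n)/Z_Λ) = (Z_{𝒜ᶜ}/Z_{𝒜ᶜ}) · Σ_{∂n=v△x} w_Λ(n)/Z_Λ`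
((2.3), (2.9)), for every real `β`. [cite: Sakai2007, (2.9) and (2.30)] -/
theorem tsum_thetaWeight_eq :
    ∑' p : Current G × Current G, thetaWeight (G := G) β A v x p =
      isingTwoPoint G univ β 0 .free v x := by
  have hZA := zOff_pos (G := G) β A
  have hZ := zOff_pos (G := G) β ∅
  rw [tsum_congr (thetaWeight_eq (G := G) β A v x), tsum_mul_left,
    ← tsum_mul_tsum_of_summable_norm (summable_weight_isSupp_offGraph (G := G) β A ∅).norm
      (summable_currentWeight_indicator_holds G β ({v} ∆ {x})).norm]
  change (zOff G β A * zOff G β ∅)⁻¹ * (zOff G β A * currentSum G β ({v} ∆ {x})) = _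
  rw [twoPoint_eq_div]
  field_simp

end Weights

/-! ## Linearity of `Θ` in `X` -/

section Linear

variable {β : ℝ} {A : Finset V} {v x : V}

/-- `Θ[X + Y] = Θ[X] + Θ[Y]` for bounded `X, Y`. [cite: Sakai2007, §2.2.3 ((2.41)–(2.42))] -/
theorem theta_add {X Y : Current G → ℝ} (hX : ∃ C, ∀ N, |X N| ≤ C) (hY : ∃ C, ∀ N, |Y N| ≤ C) :
    theta G β A v x (fun N => X N + Y N) = theta G β A v x X + theta G β A v x Y := by
  classical
  obtain ⟨C, hC⟩ := hX
  obtain ⟨D, hD⟩ := hY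
  rw [theta_eq_tsum, theta_eq_tsum, theta_eq_tsum,
    ← (summable_thetaSummand hC).tsum_add (summable_thetaSummand hD)]
  refine tsum_congr fun p => ?_
  split_ifs <;> ring

/-- `Θ[X - Y] = Θ[X] - Θ[Y]` for bounded `X, Y`. [cite: Sakai2007, §2.2.3 ((2.41)–(2.42))] -/
theorem theta_sub {X Y : Current G → ℝ} (hX : ∃ C, ∀ N, |X N| ≤ C) (hY : ∃ C, ∀ N, |Y N| ≤ C) :
    theta G β A v x (fun N => X N - Y N) = theta G β A v x X - theta G β A v x Y := by
  classical
  obtain ⟨C, hC⟩ := hX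
  obtain ⟨D, hD⟩ := hY
  rw [theta_eq_tsum, theta_eq_tsum, theta_eq_tsum,
    ← (summable_thetaSummand hC).tsum_sub (summable_thetaSummand hD)]
  refine tsum_congr fun p => ?_
  split_ifs <;> ring

/-- `Θ[c X] = c Θ[X]`. [cite: Sakai2007, §2.2.3 ((2.41)–(2.42))] -/
theorem theta_const_mul (c : ℝ) (X : Current G → ℝ) :
    theta G β A v x (fun N => c * X N) = c * theta G β A v x X := by
  classical
  rw [theta_eq_tsum, theta_eq_tsum, ← tsum_mul_left]
  refine tsum_congr fun p => ?_
  split_ifs <;> ring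

/-- `Θ[X c] = Θ[X] c`. [cite: Sakai2007, §2.2.3 ((2.41)–(2.42))] -/
theorem theta_mul_const (X : Current G → ℝ) (c : ℝ) :
    theta G β A v x (fun N => X N * c) = theta G β A v x X * c := by
  rw [mul_comm, ← theta_const_mul c X]
  exact congrArg _ (funext fun N => mul_comm _ _)

/-- `Θ` of a constant: `Θ[c] = c · Θ[1]`. [cite: Sakai2007, (2.30) (Θ_{v,x;𝒜} = Θ_{v,x;𝒜}[1])] -/
theorem theta_const (c : ℝ) :
    theta G β A v x (fun _ => c) = c * theta G β A v x (fun _ => 1) := by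
  rw [← theta_const_mul c]
  simp only [mul_one]

/-- `Θ[Σ_{i ∈ s} X_i] = Σ_{i ∈ s} Θ[X_i]` for bounded `X_i`. [cite: Sakai2007, §2.2.3 ((2.41)–(2.42))] -/
theorem theta_finset_sum {ι : Type*} (s : Finset ι) {X : ι → Current G → ℝ}
    (hX : ∀ i, ∃ C, ∀ N, |X i N| ≤ C) :
    theta G β A v x (fun N => ∑ i ∈ s, X i N) = ∑ i ∈ s, theta G β A v x (X i) := by
  classical
  induction s using Finset.induction_on with
  | empty =>
    simp only [Finset.sum_empty]
    have h := theta_const_mul (G := G) (β := β) (A := A) (v := v) (x := x) 0 (fun _ => 1)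
    simp only [zero_mul] at h
    exact h
  | insert i s hi ih =>
    simp only [Finset.sum_insert hi]
    rw [← ih]
    refine theta_add (hX i) ?_
    choose C hC using hX
    refine ⟨∑ j ∈ s, C j, fun N => (Finset.abs_sum_le_sum_abs _ _).trans ?_⟩
    exact Finset.sum_le_sum fun j _ => hC j N

/-- `Θ[Σ_i X_i c_i] = Σ_i Θ[X_i] c_i` for bounded `X_i` (the form in which (2.35) is substituted
into the innermost `Θ`: the bond sum `Σ_{b'} (…) τ_{b'} ⟨φ_{b̄'}φ_x⟩_Λ` is pulled out).
[cite: Sakai2007, §2.2.3 ((2.41)–(2.42))] -/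
theorem theta_sum_mul {ι : Type*} [Fintype ι] {X : ι → Current G → ℝ}
    (hX : ∀ i, ∃ C, ∀ N, |X i N| ≤ C) (c : ι → ℝ) :
    theta G β A v x (fun N => ∑ i, X i N * c i) = ∑ i, theta G β A v x (X i) * c i := by
  have hX' : ∀ i, ∃ C, ∀ N, |X i N * c i| ≤ C := fun i => by
    obtain ⟨C, hC⟩ := hX i
    exact ⟨C * |c i|, fun N => by rw [abs_mul]; exact mul_le_mul_of_nonneg_right (hC N) (abs_nonneg _)⟩
  rw [theta_finset_sum univ hX']
  exact Finset.sum_congr rfl fun i _ => theta_mul_const (X i) (c i)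

end Linear

/-! ## Ferromagnetic case: monotonicity and bounds -/

section Ferro

variable {β : ℝ} {A : Finset V} {v x : V}

/-- Monotonicity of `Θ` in `X` for `β ≥ 0` (bounded arguments). [cite: Sakai2007, §2.2.3 (last paragraph)] -/
theorem theta_mono (hβ : 0 ≤ β) {X Y : Current G → ℝ} (hX : ∃ C, ∀ N, |X N| ≤ C)
    (hY : ∃ C, ∀ N, |Y N| ≤ C) (hXY : ∀ N, X N ≤ Y N) :
    theta G β A v x X ≤ theta G β A v x Y := by
  have h := theta_sub (G := G) (β := β) (A := A) (v := v) (x := x) hY hX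
  have h0 : 0 ≤ theta G β A v x (fun N => Y N - X N) :=
    theta_nonneg hβ A v x fun N => sub_nonneg.2 (hXY N)
  linarith

/-- **`|Θ_{v,x;𝒜}[X]| ≤ (sup |X|) · ⟨φ_vφ_x⟩_Λ`** for `β ≥ 0`: drop the indicator of
`E_{m+n}(v,x;𝒜)` and use the total mass `tsum_thetaWeight_eq`. [cite: Sakai2007, (2.30) and §2.2.3] -/
theorem abs_theta_le (hβ : 0 ≤ β) {X : Current G → ℝ} {C : ℝ} (hX : ∀ N, |X N| ≤ C) :
    |theta G β A v x X| ≤ C * isingTwoPoint G univ β 0 .free v x := by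
  classical
  have hC : 0 ≤ C := (abs_nonneg _).trans (hX 0)
  rw [theta_eq_tsum, ← tsum_thetaWeight_eq β A v x, ← tsum_mul_left]
  have hs := summable_thetaSummand (G := G) (β := β) (A := A) (v := v) (x := x) hX
  have hs' : Summable fun p : Current G × Current G => C * thetaWeight (G := G) β A v x p :=
    (summable_thetaWeight_mul (Φ := fun _ => (1 : ℝ)) (C := 1) fun _ => by simp).mul_left C
      |>.congr fun p => by ring
  refine (Real.norm_eq_abs _ ▸ norm_tsum_le_tsum_norm hs.norm).trans ?_
  refine hs.norm.tsum_le_tsum (fun p => ?_) hs'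
  rw [Real.norm_eq_abs, abs_mul, abs_of_nonneg (thetaWeight_nonneg hβ p), mul_comm]
  refine mul_le_mul_of_nonneg_right ?_ (thetaWeight_nonneg hβ p)
  split_ifs
  · exact hX _
  · rw [abs_zero]; exact hC

/-- `|Θ_{v,x;𝒜}[X]| ≤ sup |X|` for `β ≥ 0` (as `⟨φ_vφ_x⟩_Λ ≤ 1`). [cite: Sakai2007, (2.30) and §2.2.3] -/
theorem abs_theta_le' (hβ : 0 ≤ β) {X : Current G → ℝ} {C : ℝ} (hX : ∀ N, |X N| ≤ C) :
    |theta G β A v x X| ≤ C := by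
  have hC : 0 ≤ C := (abs_nonneg _).trans (hX 0)
  refine (abs_theta_le hβ hX).trans ?_
  have h1 := (le_abs_self _).trans (abs_isingTwoPoint_le_one G univ β 0 .free v x)
  nlinarith

/-- `0 ≤ ⟨φ_xφ_y⟩_{𝒜ᶜ}` for `β ≥ 0` (a ratio of nonnegative current sums, (2.5)). [cite: Sakai2007, (2.5)] -/
theorem twoPointOff_nonneg (hβ : 0 ≤ β) (A : Finset V) (x y : V) : 0 ≤ twoPointOff G β A x y := by
  by_cases h : x ∉ A ∧ y ∉ A
  · rw [twoPointOff_eq_div β h.1 h.2]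
    exact div_nonneg (currentSum_nonneg _ hβ _) (zOff_pos β A).le
  · rw [twoPointOff_of_not β h]

/-- `|⟨φ_yφ_x⟩_Λ - ⟨φ_yφ_x⟩_{𝒜ᶜ}| ≤ 1` for `β ≥ 0` (`0 ≤ ⟨·⟩_{𝒜ᶜ} ≤ ⟨·⟩_Λ ≤ 1`). [cite: Sakai2007, Proposition 2.2] -/
theorem abs_twoPoint_sub_twoPointOff_le_one (hβ : 0 ≤ β) (A : Finset V) (y x : V) :
    |isingTwoPoint G univ β 0 .free y x - twoPointOff G β A y x| ≤ 1 := by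
  have h1 := twoPointOff_le_twoPoint (G := G) hβ A y x
  have h2 := twoPointOff_nonneg (G := G) hβ A y x
  have h3 := (le_abs_self _).trans (abs_isingTwoPoint_le_one G univ β 0 .free y x)
  rw [abs_le]
  constructor <;> linarith

/-- **A priori bound on the nested kernels (2.39)**: `0 ≤ piKernel k ≤ |𝔻|^k` for `β ≥ 0`
(`|𝔻|` = number of directed bonds; each level is a bond sum of `Θ`'s of functions bounded by the
previous level, `|τ_b| ≤ 1`). [cite: Sakai2007, (2.39) and §2.2.3] -/
theorem piKernel_le_pow (hβ : 0 ≤ β) (k : ℕ) :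
    ∀ (A : Finset V) (v x : V), piKernel G β k A v x ≤ (Fintype.card G.Dart : ℝ) ^ k := by
  induction k with
  | zero =>
    intro A v x
    rw [pow_zero]
    exact (le_abs_self _).trans (abs_theta_le' (C := 1) hβ fun _ => by simp)
  | succ k ih =>
    intro A v x
    rw [piKernel]
    calc ∑ d : G.Dart, theta G β A v d.fst
          (fun N => Real.tanh β * piKernel G β k (clusterOff G N (dartEdge G d) v) d.snd x)
        ≤ ∑ _d : G.Dart, (Fintype.card G.Dart : ℝ) ^ k := by
          refine Finset.sum_le_sum fun d _ => (le_abs_self _).trans (abs_theta_le' hβ fun N => ?_)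
          rw [abs_mul, abs_of_nonneg (piKernel_nonneg hβ k _ _ _)]
          calc |Real.tanh β| * piKernel G β k (clusterOff G N (dartEdge G d) v) d.snd x
              ≤ 1 * (Fintype.card G.Dart : ℝ) ^ k :=
                mul_le_mul (abs_tanh_le_one β) (ih _ _ _) (piKernel_nonneg hβ k _ _ _) zero_le_one
            _ = _ := one_mul _
      _ = (Fintype.card G.Dart : ℝ) ^ (k + 1) := by
          rw [Finset.sum_const, Finset.card_univ, nsmul_eq_mul, pow_succ, mul_comm]

/-- `|piKernel k| ≤ |𝔻|^k` for `β ≥ 0`. [cite: Sakai2007, (2.39) and §2.2.3] -/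
theorem abs_piKernel_le_pow (hβ : 0 ≤ β) (k : ℕ) (A : Finset V) (v x : V) :
    |piKernel G β k A v x| ≤ (Fintype.card G.Dart : ℝ) ^ k := by
  rw [abs_of_nonneg (piKernel_nonneg hβ k A v x)]
  exact piKernel_le_pow hβ k A v x

/-- **A priori bound on the nested remainders (2.40)**: `|rKernel k| ≤ |𝔻|^{k+1}` for `β ≥ 0`.
[cite: Sakai2007, (2.40) and §2.2.3] -/
theorem abs_rKernel_le_pow (hβ : 0 ≤ β) (k : ℕ) :
    ∀ (A : Finset V) (v x : V), |rKernel G β k A v x| ≤ (Fintype.card G.Dart : ℝ) ^ (k + 1) := by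
  induction k with
  | zero =>
    intro A v x
    rw [rKernel, zero_add, pow_one]
    calc |∑ d : G.Dart, theta G β A v d.fst (fun N => Real.tanh β *
            (isingTwoPoint G univ β 0 .free d.snd x -
              twoPointOff G β (clusterOff G N (dartEdge G d) v) d.snd x))|
        ≤ ∑ d : G.Dart, |theta G β A v d.fst (fun N => Real.tanh β *
            (isingTwoPoint G univ β 0 .free d.snd x -
              twoPointOff G β (clusterOff G N (dartEdge G d) v) d.snd x))| :=
          Finset.abs_sum_le_sum_abs _ _
      _ ≤ ∑ _d : G.Dart, (1 : ℝ) := by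
          refine Finset.sum_le_sum fun d _ => abs_theta_le' hβ fun N => ?_
          rw [abs_mul]
          calc |Real.tanh β| * |isingTwoPoint G univ β 0 .free d.snd x -
                twoPointOff G β (clusterOff G N (dartEdge G d) v) d.snd x|
              ≤ 1 * 1 := mul_le_mul (abs_tanh_le_one β)
                (abs_twoPoint_sub_twoPointOff_le_one hβ _ _ _) (abs_nonneg _) zero_le_one
            _ = 1 := one_mul _
      _ = (Fintype.card G.Dart : ℝ) := by
          rw [Finset.sum_const, Finset.card_univ, nsmul_eq_mul, mul_one]
  | succ k ih =>
    intro A v x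
    rw [rKernel]
    calc |∑ d : G.Dart, theta G β A v d.fst
            (fun N => Real.tanh β * rKernel G β k (clusterOff G N (dartEdge G d) v) d.snd x)|
        ≤ ∑ d : G.Dart, |theta G β A v d.fst
            (fun N => Real.tanh β * rKernel G β k (clusterOff G N (dartEdge G d) v) d.snd x)| :=
          Finset.abs_sum_le_sum_abs _ _
      _ ≤ ∑ _d : G.Dart, (Fintype.card G.Dart : ℝ) ^ (k + 1) := by
          refine Finset.sum_le_sum fun d _ => abs_theta_le' hβ fun N => ?_
          rw [abs_mul]
          calc |Real.tanh β| * |rKernel G β k (clusterOff G N (dartEdge G d) v) d.snd x|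
              ≤ 1 * (Fintype.card G.Dart : ℝ) ^ (k + 1) :=
                mul_le_mul (abs_tanh_le_one β) (ih _ _ _) (abs_nonneg _) zero_le_one
            _ = _ := one_mul _
      _ = (Fintype.card G.Dart : ℝ) ^ (k + 1 + 1) := by
          rw [Finset.sum_const, Finset.card_univ, nsmul_eq_mul, pow_succ _ (k + 1), mul_comm]

/-- **`R` is nonnegative in the ferromagnetic case**: `0 ≤ rKernel k` for `β ≥ 0`, "with the help of
Proposition 2.2" (`⟨φ_{b̄}φ_x⟩_{𝒞ᶜ} ≤ ⟨φ_{b̄}φ_x⟩_Λ` at the innermost level) and the nonnegativity of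
all weights. [cite: Sakai2007, Proposition 1.1 ((1.13)) and §2.2.3 (last paragraph)] -/
theorem rKernel_nonneg (hβ : 0 ≤ β) (k : ℕ) :
    ∀ (A : Finset V) (v x : V), 0 ≤ rKernel G β k A v x := by
  have hτ := tanh_nonneg_of_nonneg hβ
  induction k with
  | zero =>
    intro A v x
    rw [rKernel]
    exact Finset.sum_nonneg fun d _ => theta_nonneg hβ _ _ _ fun N =>
      mul_nonneg hτ (sub_nonneg.2 (twoPointOff_le_twoPoint hβ _ _ _))
  | succ k ih =>
    intro A v x
    rw [rKernel]
    exact Finset.sum_nonneg fun d _ => theta_nonneg hβ _ _ _ fun N => mul_nonneg hτ (ih _ _ _)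

end Ferro

end IsingLace

end Literature.Probability.LatticeModels

end
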